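import Mathlib
import Literature.Topology.FourManifolds.TrisectionFunctor
import Literature.Topology.FourManifolds.Trisections
import Literature.Topology.FourManifolds.GroupTrisections
import Literature.Topology.FourManifolds.TrisectionCentralSurfaceMarking
import Literature.Topology.FourManifolds.LickorishWallaceLeaves
import Literature.Topology.FourManifolds.LickorishWallaceHandlebodies
import Literature.Topology.FourManifolds.OneHandleStepExists
import Literature.Topology.FourManifolds.SPC4HandlesProofs
import Literature.Topology.FourManifolds.GenusOneHandlebodyBoundary
import Literature.Topology.FourManifolds.NormalRetraction
import Literature.Topology.FourManifolds.SmoothEmbeddingCriteria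
import Literature.Topology.FourManifolds.BallGluingCharts
import HarnessLib

/-!
# DehnNielsenBaerSurface

Topic `Literature/Topology/FourManifolds`. Named literature fact(s) relocated by the gate from `Summits/SmoothPoincare4/SmoothPoincare4/Theorems/CongruenceShadowsAgkCor6SufficiencyStubDehnNielsenBaer.lean`
(accept-time relocation of `[cite]`d propositions written inline in a Summits proposal; human ruling 2026-08-15).
Sources: FarbMargalit2012, ZieschangVogtColdewey1980.

* `Literature.Topology.FourManifolds.DehnNielsenBaerSurfaceSmooth`
-/

namespace Literature.Topology.FourManifolds

open Set Function
open scoped _root_.Manifold _root_.ContDiff _root_.Topology _root_.ContinuousMap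
open Literature.Topology.FourManifolds

/-- **Smooth based Dehn–Nielsen–Baer on the boundary surface of a handlebody** (the classical
input of `stub_dehnNielsenBaer`; NOT asserted — registered as the delegated fact `stub_dnbSurface`).
For a genus-`g` handlebody `H` (`IsHandlebody g H`) with boundary datum `b` (`b.carrier ≅ ∂H`, the
closed orientable surface of genus `g`), any two markings `ν : S_g ≅ π₁(b.carrier, z)`,
`ν' : S_g ≅ π₁(b.carrier, z')` differ by a based DIFFEOMORPHISM `φ` of `b.carrier`:
`φ z = z'` and `φ_* ∘ ν = ν'`.  Equivalently: every automorphism of `π₁(Σ_g, z)` — orientation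
reversing ones included — is induced by a based diffeomorphism (Dehn–Nielsen–Baer surjectivity
`Mod^±(Σ_g) ↠ Out π₁ Σ_g`, Nielsen 1927 / Baer 1928, with the Birman exact sequence for the based
form; `g = 0`: `S_0 = 1`, homogeneity; `g = 1`: `GL₂(ℤ)` acting linearly on `T²`), and base points are
moved by isotopies.  J. Nielsen, *Untersuchungen zur Topologie der geschlossenen zweiseitigen
Flächen*, Acta Math. 50 (1927); H. Zieschang, E. Vogt, H.-D. Coldewey, *Surfaces and planar
discontinuous groups*, LNM 835 (1980), Thm. 5.6.1–5.6.2 (every automorphism of the surface group is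
induced by a homeomorphism); B. Farb, D. Margalit, *A primer on mapping class groups* (2012),
Thm. 8.1 (Dehn–Nielsen–Baer `Mod^±(S_g) ≅ Out π₁(S_g)`), Thm. 4.6 (Birman exact sequence: inner
automorphisms are point pushes — the based form `Mod^±(S_g, z) ↠ Aut π₁(S_g, z)`), §1.4 (smooth =
topological mapping class groups: the realising map may be taken smooth, base points moved by
diffeotopies).  (Tree shape of the same theorem: hypothesis `hDNB` of
`exists_heegaardSplitting_realizing_kernels_of_stronglyEquivalent_of_dehnNielsenBaer`.)
[cite: ZieschangVogtColdewey1980, Thm. 5.6.1 and Thm. 5.6.2] [cite: FarbMargalit2012, Thm. 8.1 and Thm. 4.6]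
[file Topology/FourManifolds/DehnNielsenBaerSurface] -/
def DehnNielsenBaerSurfaceSmooth : Prop :=
  ∀ (g : ℕ) (H : Type) [TopologicalSpace H] [T2Space H] [SecondCountableTopology H]
    [ChartedSpace (EuclideanHalfSpace 3) H] [IsManifold (𝓡∂ 3) ∞ H] (_ : IsHandlebody g H)
    (b : BoundaryData (𝓡∂ 3) H (𝓡 2)) (z z' : b.carrier)
    (ν : SurfaceGroup g ≃* FundamentalGroup b.carrier z)
    (ν' : SurfaceGroup g ≃* FundamentalGroup b.carrier z'),
    ∃ (φ : b.carrier ≃ₘ⟮𝓡 2, 𝓡 2⟯ b.carrier) (hφ : φ z = z'),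
      ∀ γ : SurfaceGroup g,
        FundamentalGroup.mapOfEq (⟨φ, φ.continuous⟩ : C(b.carrier, b.carrier)) hφ (ν γ) = ν' γ

/-! ## Ambient smoothness: private copies of `Literature/Topology/FourManifolds/AmbientSmoothExtension.lean` -/

end Literature.Topology.FourManifolds
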